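import Literature.AnabelianGeometry.SemiGraphs.CuspEdgePack
import Literature.AnabelianGeometry.SemiGraphs.TemperedSpecialFibreCuspBranches
import Literature.AnabelianGeometry.SemiGraphs.TemperedReconstructionCor39IsoFinite
import Literature.AnabelianGeometry.SemiGraphs.TemperedCuspOmissionHypotheses
import HarnessLib

/-!
# [SemiAnbd] Cor. 3.11, step (C): the extension along the cusps CONSTRUCTED from a cusp matching —
# (S3′) and Cor. 3.11 from (S1), (S2) and the cusp-matching step `CuspBranchesPreserved` (proof-only)

Mochizuki, *Semi-graphs of anabelioids*, Publ. RIMS **42** (2006), §3, Corollary 3.11, proof pp. 46–48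
[cite: MochizukiSemiAnbd2006, Cor 3.11 pp.46-48]: "it follows formally from (i), (ii), (iii), (iv) that
the natural, functorial isomorphism of graphs of anabelioids `G[α]_Σ ⥲ G[β]_Σ` induced by `γ` extends
uniquely to a natural, functorial isomorphism of semi-graphs of anabelioids `G^c[α]_Σ ⥲ G^c[β]_Σ`".

PROOF-ONLY file (abc-iut cell, layer L3, sub-DAG SemiAnbd-Cor311, row «Cor311·C∃-LOCAL», seat
abc-iut-w4-d083).  The "formally" of the printed sentence, in kernel: GIVEN the cusp matching
(`SpecialFibreData.CuspMatching`, the output of observations (i)–(iv); typed over the origin hypotheses as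
`CuspBranchesPreserved`, `TemperedSpecialFibreCuspBranches.lean`), the isomorphism `F₀ : G[α] ⥲ G[β]` of the
graphs of anabelioids without compact structure EXTENDS to an isomorphism `F : G^c[α] ⥲ G^c[β]` of the
semi-graphs of anabelioids with compact structure, chart-compatible with `φ` — assembled edge by edge
(`EdgePack.hom`, `HomOfEdgePacks.lean`) from the packages of the closed edges (read off `F₀`,
`packClosed`) and of the matched cusps (`CuspDatum.packOpen`, `CuspEdgePack.lean`):

* `SpecialFibreData.exists_cuspExtension_of_cuspMatching` — the EXISTENCE clause of step (C) for an
  isomorphism `F₀` matching the cusps (its uniqueness clause is `cuspExtensionUnique_uniqueness_holds`);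
* `specialFibreIsoOfDescendedIso_of_cuspBranchesPreserved` — (S3′) `SpecialFibreIsoOfDescendedIso Ωα Ωβ`
  from `CuspBranchesPreserved Ωα Ωβ` and the finiteness of the certified special fibres (Cor. 3.9 at the
  finite graphs `G[□]` in its isomorphism form, `SpecialFibreData.exists_isIso_graphCompatible_of_finite`;
  the cusp extension; the proved uniqueness);
* `SpecialFibreData.isIso_of_graphCompatible_of_finite` — at finite special fibres every `φ`-compatible
  `F₀ : G[α] → G[β]` is an isomorphism; hence `cuspExtensionUnique_of_cuspBranchesPreserved` — step (C)
  as typed (`CuspExtensionUnique Ωα Ωβ`) FOLLOWS from `CuspBranchesPreserved Ωα Ωβ` (finite special fibres);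
* `corollary_3_11_of_steps_cuspBranches` — `Cor311` from (S1), (S2), `CuspBranchesPreserved` and the
  finiteness: the residual FACT content of the printed proof of Cor. 3.11 is thereby (S1) (admissible
  quotient), (S2) (`p_α = p_β`) and the cusp matching (print's (ii)–(iv)).

No definition; nothing of the frozen files is altered; nothing here takes a side on [IUTchIII] Cor. 3.12;
typed ≠ proved for (S1), (S2), `CuspBranchesPreserved`.
-/

open CategoryTheory Topology

noncomputable section

namespace Literature.AnabelianGeometry.SemiGraphs

open ProfiniteSemiGraph

universe u

variable {Kα : Type u} [Field Kα] {Kβ : Type u} [Field Kβ]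

namespace SpecialFibreData

variable {Dα : TemperedArithmeticGroup Kα} {Dβ : TemperedArithmeticGroup Kβ}
  (Sα : SpecialFibreData Dα) (Sβ : SpecialFibreData Dβ)

/-- **Step (C), existence, from a cusp matching**: an isomorphism `F₀ : G[α] ⥲ G[β]` of the graphs of
anabelioids without compact structure that matches the cusps extends to an isomorphism
`F : G^c[α] ⥲ G^c[β]` of the semi-graphs of anabelioids with compact structure, chart-compatible with any
`φ` with which `F₀` is compatible on vertices (p. 47: "extends … to a natural, functorial isomorphism of
semi-graphs of anabelioids"). [cite: MochizukiSemiAnbd2006, Cor 3.11 p.47] -/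
theorem exists_cuspExtension_of_cuspMatching (φ : Sα.chart.G ≃ₜ* Sβ.chart.G)
    (F₀ : Hom Sα.graph Sβ.graph) (hF₀ : F₀.IsIso) (hc : Sα.GraphCompatible Sβ φ F₀)
    (hm : Sα.CuspMatching Sβ F₀) :
    ∃ F : Hom Sα.Gc Sβ.Gc, F.IsIso ∧ F.ExtendsBase F₀ ∧ Sα.ChartCompatible Sβ φ F := by
  classical
  obtain ⟨σ, hσ⟩ := hm
  have hα := Sα.hyp.toProp36Hypotheses.maximalSubgraph_isCuspOmission
  have hβ := Sβ.hyp.toProp36Hypotheses.maximalSubgraph_isCuspOmission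
  have hinjα := Sα.hyp.toProp36Hypotheses.isOfInjectiveType
  have hinjβ := Sβ.hyp.toProp36Hypotheses.isOfInjectiveType
  -- a cusp datum at every open edge, matched through `σ`
  have hD : ∀ (e : Sα.Gc.graph.Edge) (he : ¬ Sα.Gc.graph.IsClosedEdge e),
      ∃ D : EdgePack.CuspDatum (vertexMapMax F₀) (hVMax F₀) e,
        Sβ.Gc.graph.edgeOf D.b' = (σ ⟨e, he⟩).1 := by
    intro e he
    obtain ⟨b, hbe, hbs, huniq⟩ := hα.existsUnique_abuts e he
    obtain ⟨v, hb⟩ := Option.isSome_iff_exists.mp hbs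
    obtain ⟨b', hb', g, hedge, hmatch⟩ := hσ ⟨e, he⟩ b v hbe hb
    have hopen' : ¬ Sβ.Gc.graph.IsClosedEdge (Sβ.Gc.graph.edgeOf b') := by rw [hedge]; exact (σ ⟨e, he⟩).2
    obtain ⟨b₀, hb₀e, -, hu⟩ := hβ.existsUnique_abuts (Sβ.Gc.graph.edgeOf b') hopen'
    have hb'₀ : b' = b₀ := hu b' rfl (by rw [hb']; rfl)
    exact ⟨⟨b, v, hbe, hb, huniq, b', hb', fun d hd hds => (hu d hd hds).trans hb'₀.symm, g, hmatch⟩,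
      hedge⟩
  choose D hDσ using hD
  let P : ∀ e, EdgePack (vertexMapMax F₀) (hVMax F₀) e := fun e =>
    if he : Sα.Gc.graph.IsClosedEdge e then packClosed F₀ e he else (D e he).packOpen hinjβ
  have hPc : ∀ e (he : Sα.Gc.graph.IsClosedEdge e), P e = packClosed F₀ e he := fun e he => dif_pos he
  have hPo : ∀ e (he : ¬ Sα.Gc.graph.IsClosedEdge e), P e = (D e he).packOpen hinjβ :=
    fun e he => dif_neg he
  refine ⟨EdgePack.hom P, ?_, ?_, ?_⟩
  · refine EdgePack.hom_isIso P ?_ ?_ (fun v => hF₀.isLocallyTrivial.1 _) ?_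
    · -- the vertex map
      refine ⟨fun v₁ v₂ h => ?_, fun w => ?_⟩
      · have h1 : F₀.base.vertexMap ⟨v₁, Set.mem_univ v₁⟩ = F₀.base.vertexMap ⟨v₂, Set.mem_univ v₂⟩ :=
          Subtype.ext h
        exact congrArg Subtype.val (hF₀.bijective_vertexMap.1 h1)
      · obtain ⟨u, hu⟩ := hF₀.bijective_vertexMap.2 ⟨w, Set.mem_univ w⟩
        exact ⟨u.1, by change (F₀.base.vertexMap ⟨u.1, _⟩).1 = w; rw [show (⟨u.1, Set.mem_univ u.1⟩ :
          Sα.graph.graph.Vertex) = u from rfl, hu]⟩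
    · -- the edge assignment
      refine ⟨fun e₁ e₂ h => ?_, fun f => ?_⟩
      · change (P e₁).f = (P e₂).f at h
        by_cases h₁ : Sα.Gc.graph.IsClosedEdge e₁ <;> by_cases h₂ : Sα.Gc.graph.IsClosedEdge e₂
        · rw [hPc e₁ h₁, hPc e₂ h₂] at h
          change (F₀.base.edgeMap ⟨e₁, h₁⟩).1 = (F₀.base.edgeMap ⟨e₂, h₂⟩).1 at h
          exact congrArg Subtype.val (hF₀.bijective_edgeMap.1 (Subtype.ext h))
        · exfalso
          rw [hPc e₁ h₁, hPo e₂ h₂] at h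
          change (F₀.base.edgeMap ⟨e₁, h₁⟩).1 = Sβ.Gc.graph.edgeOf (D e₂ h₂).b' at h
          have := (F₀.base.edgeMap ⟨e₁, h₁⟩).2
          rw [h, hDσ] at this
          exact (σ ⟨e₂, h₂⟩).2 this
        · exfalso
          rw [hPo e₁ h₁, hPc e₂ h₂] at h
          change Sβ.Gc.graph.edgeOf (D e₁ h₁).b' = (F₀.base.edgeMap ⟨e₂, h₂⟩).1 at h
          have := (F₀.base.edgeMap ⟨e₂, h₂⟩).2
          rw [← h, hDσ] at this
          exact (σ ⟨e₁, h₁⟩).2 this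
        · rw [hPo e₁ h₁, hPo e₂ h₂] at h
          change Sβ.Gc.graph.edgeOf (D e₁ h₁).b' = Sβ.Gc.graph.edgeOf (D e₂ h₂).b' at h
          rw [hDσ, hDσ] at h
          exact congrArg Subtype.val (σ.injective (Subtype.ext h))
      · by_cases hf : Sβ.Gc.graph.IsClosedEdge f
        · obtain ⟨e, he⟩ := hF₀.bijective_edgeMap.2 ⟨f, hf⟩
          refine ⟨e.1, ?_⟩
          change (P e.1).f = f
          rw [hPc e.1 e.2]
          change (F₀.base.edgeMap ⟨e.1, e.2⟩).1 = f
          rw [show (⟨e.1, e.2⟩ : Sα.graph.graph.Edge) = e from rfl, he]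
        · refine ⟨(σ.symm ⟨f, hf⟩).1, ?_⟩
          change (P _).f = f
          rw [hPo _ (σ.symm ⟨f, hf⟩).2]
          change Sβ.Gc.graph.edgeOf (D _ _).b' = f
          rw [hDσ, show (⟨(σ.symm ⟨f, hf⟩).1, (σ.symm ⟨f, hf⟩).2⟩ : {e : Sα.Gc.graph.Edge //
            ¬ Sα.Gc.graph.IsClosedEdge e}) = σ.symm ⟨f, hf⟩ from rfl, σ.apply_symm_apply]
    · -- the edge homomorphisms
      intro e
      by_cases he : Sα.Gc.graph.IsClosedEdge e
      · rw [hPc e he]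
        exact hF₀.isLocallyTrivial.2 ⟨e, he⟩
      · rw [hPo e he]
        exact (D e he).eta_bijective hinjβ hinjα (hF₀.isLocallyTrivial.1 _).1
  · refine ⟨fun v => rfl, fun e => ?_⟩
    change (P e.1).f = (F₀.base.edgeMap e).1
    rw [hPc e.1 e.2]
    rfl
  · intro v ψα ψβ hψα hψβ
    exact hc.1 ⟨v, Set.mem_univ v⟩ ψα ψβ hψα hψβ

/-- At FINITE special fibres every morphism `F₀ : G[α] → G[β]` compatible with an isomorphism `φ` on
verticial and edge homomorphisms is an isomorphism (`isIso_of_compat_equiv_of_finite` through the charts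
of `G^c[□]` transported along the cusp omission). [cite: MochizukiSemiAnbd2006, Cor 3.11 p.46] -/
theorem isIso_of_graphCompatible_of_finite [Finite Sα.Gc.graph.Vertex] [Finite Sα.Gc.graph.Edge]
    [Finite Sβ.Gc.graph.Vertex] [Finite Sβ.Gc.graph.Edge] (φ : Sα.chart.G ≃ₜ* Sβ.chart.G)
    (F₀ : Hom Sα.graph Sβ.graph) (hc : Sα.GraphCompatible Sβ φ F₀) : F₀.IsIso := by
  haveI := Sα.finite_graph_vertex; haveI := Sα.finite_graph_edge
  haveI := Sβ.finite_graph_vertex; haveI := Sβ.finite_graph_edge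
  have hα := Sα.hyp.toProp36Hypotheses.maximalSubgraph_isCuspOmission
  have hβ := Sβ.hyp.toProp36Hypotheses.maximalSubgraph_isCuspOmission
  haveI := isEquivalence_btempRestrict hα
  haveI := isEquivalence_btempRestrict hβ
  let eα := (Sα.Gc.btempRestrict Sα.Gc.graph.maximalSubgraph).asEquivalence
  let eβ := (Sβ.Gc.btempRestrict Sβ.Gc.graph.maximalSubgraph).asEquivalence
  let cα : TemperedPiChart Sα.graph := Sα.chart.transport eα.symm
  let cβ : TemperedPiChart Sβ.graph := Sβ.chart.transport eβ.symm
  have hV : F₀.CompatV cα cβ (φ : Sα.chart.G →ₜ* Sβ.chart.G) := fun v ψ ψ' hψ hψ' =>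
    hc.1 v ψ ψ' hψ hψ'
  have hE : F₀.CompatE cα cβ (φ : Sα.chart.G →ₜ* Sβ.chart.G) := fun e ψ ψ' hψ hψ' =>
    hc.2 e ψ ψ' hψ hψ'
  exact isIso_of_compat_equiv_of_finite Sα.cor39Hypotheses_graph Sβ.cor39Hypotheses_graph cα cβ φ F₀ hV hE

end SpecialFibreData

/-- **(S3′) from the cusp-matching step**: `SpecialFibreIsoOfDescendedIso Ωα Ωβ` follows from
`CuspBranchesPreserved Ωα Ωβ` whenever the origin hypotheses certify only special-fibre data with finite
semi-graphs — Cor. 3.9 at the finite graphs `G[□]` gives the isomorphism `F₀ : G[α] ⥲ G[β]`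
(`exists_isIso_graphCompatible_of_finite`), the cusp matching extends it to `G^c[α] ⥲ G^c[β]`
(`exists_cuspExtension_of_cuspMatching`), uniqueness is `chartCompatible_base_maps_unique`.
[cite: MochizukiSemiAnbd2006, Cor 3.11 pp.46-48] -/
theorem specialFibreIsoOfDescendedIso_of_cuspBranchesPreserved (Ωα : SpecialFibreOrigin Kα)
    (Ωβ : SpecialFibreOrigin Kβ)
    (hfinα : ∀ (D : TemperedArithmeticGroup Kα) (S : SpecialFibreData D), Ωα.IsSpecialFibreOf D S →
      Finite S.Gc.graph.Vertex ∧ Finite S.Gc.graph.Edge)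
    (hfinβ : ∀ (D : TemperedArithmeticGroup Kβ) (S : SpecialFibreData D), Ωβ.IsSpecialFibreOf D S →
      Finite S.Gc.graph.Vertex ∧ Finite S.Gc.graph.Edge)
    (hCB : CuspBranchesPreserved Ωα Ωβ) : SpecialFibreIsoOfDescendedIso Ωα Ωβ := by
  intro Dα Dβ Sα Sβ hα hβ γ φ hφ
  haveI := (hfinα Dα Sα hα).1; haveI := (hfinα Dα Sα hα).2
  haveI := (hfinβ Dβ Sβ hβ).1; haveI := (hfinβ Dβ Sβ hβ).2
  exact Sα.specialFibreIso_of_cuspExtensionIso_of_finite Sβ φ fun F₀ hF₀ hc =>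
    Sα.exists_cuspExtension_of_cuspMatching Sβ φ F₀ hF₀ hc (hCB Dα Dβ Sα Sβ hα hβ γ φ hφ F₀ hF₀ hc)


/-- **Step (C) as typed (`CuspExtensionUnique`) from the cusp-matching step**, at origins certifying
finite special fibres: a locally open `F₀ : G[α] → G[β]` compatible with `φ` is an isomorphism
(`isIso_of_graphCompatible_of_finite`), matches the cusps (`CuspBranchesPreserved`), hence extends
(`exists_cuspExtension_of_cuspMatching`); the uniqueness clause is `cuspExtensionUnique_uniqueness_holds`.
[cite: MochizukiSemiAnbd2006, Cor 3.11 pp.46-47] -/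
theorem cuspExtensionUnique_of_cuspBranchesPreserved (Ωα : SpecialFibreOrigin Kα)
    (Ωβ : SpecialFibreOrigin Kβ)
    (hfinα : ∀ (D : TemperedArithmeticGroup Kα) (S : SpecialFibreData D), Ωα.IsSpecialFibreOf D S →
      Finite S.Gc.graph.Vertex ∧ Finite S.Gc.graph.Edge)
    (hfinβ : ∀ (D : TemperedArithmeticGroup Kβ) (S : SpecialFibreData D), Ωβ.IsSpecialFibreOf D S →
      Finite S.Gc.graph.Vertex ∧ Finite S.Gc.graph.Edge)
    (hCB : CuspBranchesPreserved Ωα Ωβ) : CuspExtensionUnique Ωα Ωβ := by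
  intro Dα Dβ Sα Sβ hα hβ γ φ hφ
  haveI := (hfinα Dα Sα hα).1; haveI := (hfinα Dα Sα hα).2
  haveI := (hfinβ Dβ Sβ hβ).1; haveI := (hfinβ Dβ Sβ hβ).2
  refine ⟨fun F₀ _ hc => ?_, cuspExtensionUnique_uniqueness_holds Sα Sβ φ⟩
  have hF₀ : F₀.IsIso := Sα.isIso_of_graphCompatible_of_finite Sβ φ F₀ hc
  exact Sα.exists_cuspExtension_of_cuspMatching Sβ φ F₀ hF₀ hc
    (hCB Dα Dβ Sα Sβ hα hβ γ φ hφ F₀ hF₀ hc)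

/-- **Cor. 3.11 from (S1), (S2), the cusp-matching step and the finiteness of the special fibres**
(`corollary_3_11_of_steps'` with (S3′) supplied by `specialFibreIsoOfDescendedIso_of_cuspBranchesPreserved`):
the FACT residue of the printed proof is (S1), (S2) and print's (ii)–(iv) (`CuspBranchesPreserved`);
everything else — Cor. 3.9 at `G[□]`, the extension along the cusps, all uniqueness — is kernel-checked.
[cite: MochizukiSemiAnbd2006, Cor 3.11 pp.45-49] -/
theorem corollary_3_11_of_steps_cuspBranches (pα pβ : ℕ) [Fact pα.Prime] [Fact pβ.Prime]
    [Algebra ℚ_[pα] Kα] [FiniteDimensional ℚ_[pα] Kα] [Algebra ℚ_[pβ] Kβ] [FiniteDimensional ℚ_[pβ] Kβ]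
    (Ωα : SpecialFibreOrigin Kα) (Ωβ : SpecialFibreOrigin Kβ)
    (hfinα : ∀ (D : TemperedArithmeticGroup Kα) (S : SpecialFibreData D), Ωα.IsSpecialFibreOf D S →
      Finite S.Gc.graph.Vertex ∧ Finite S.Gc.graph.Edge)
    (hfinβ : ∀ (D : TemperedArithmeticGroup Kβ) (S : SpecialFibreData D), Ωβ.IsSpecialFibreOf D S →
      Finite S.Gc.graph.Vertex ∧ Finite S.Gc.graph.Edge)
    (hS1 : AdmissibleQuotientCompatible Ωα Ωβ) (hS2 : ResidueCharOfTemperedIso pα pβ Ωα Ωβ)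
    (hCB : CuspBranchesPreserved Ωα Ωβ) : Cor311 pα pβ Ωα Ωβ :=
  corollary_3_11_of_steps' pα pβ Ωα Ωβ hS1 hS2
    (specialFibreIsoOfDescendedIso_of_cuspBranchesPreserved Ωα Ωβ hfinα hfinβ hCB)

end Literature.AnabelianGeometry.SemiGraphs

end
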